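import Summits.AtomisticToContinuum.Crystallization.Theorems.FrustratedLawDichotomyDRowsA15Frame

/-!
# DROWS-SOUND for the A15 chunk, piece (s1) III-X: the closed kernel counts for root class X

decomp-a2c hand-2 g46 — structural share for `AperiodicFrustratedLawGap` (stmt-27623), class-D rows.  Two closed evaluations on the enumerated class-X list
`frameL rX` of `…DRowsA15Frame` (≈ 7·10³ root-centred frame vectors of squared length `< 575`): the one-pass histogram of `…DRowsBccFibres` agrees with
census's `H0` (`histOK_X`), and every vector sits on a booked shell (`coverL_X`); whence, by the converters of `…DRowsA15Frame`, ★ `fibres_X` and ★ `cover_X`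
on the `Finset` side (`a15Box rX`).  Kernel time ≈ 2 × 80 s.  DEF-FREE.
-/

namespace Summit.AtomisticToContinuum.Crystallization.Theorems.FrustratedLawDichotomyDRowsA15KernelX

open Summit.AtomisticToContinuum.Crystallization.Theorems.FrustratedLawDichotomyDRowsA15 (H0)
open Summit.AtomisticToContinuum.Crystallization.Theorems.FrustratedLawDichotomyDRowsBccTemplate (nsq)
open Summit.AtomisticToContinuum.Crystallization.Theorems.FrustratedLawDichotomyDRowsBccFibres (look histL)
open Summit.AtomisticToContinuum.Crystallization.Theorems.FrustratedLawDichotomyDRowsA15Template (a15Box)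
open Summit.AtomisticToContinuum.Crystallization.Theorems.FrustratedLawDichotomyDRowsA15Frame
  (rX frameL rX_range H0_lt_A15 fibres_of_histOK cover_of_list)

/-- (K) the one-pass histogram of the class-X list agrees with census's `H0`. -/
theorem histOK_X : (H0.all fun Dm => look (histL (frameL rX)) (Dm.1 : ℤ) == Dm.2) = true := by decide +kernel

/-- (K) every class-X frame vector of squared length `< 575` sits on a shell booked in `H0`. -/
theorem coverL_X : ∀ v ∈ frameL rX, (nsq v).toNat ∈ H0.map Prod.fst := by decide +kernel

/-- ★ FIBRES, class X: every booked shell `(D, m)` of `H0` carries exactly `m` root-centred frame vectors in `a15Box rX`. -/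
theorem fibres_X : ∀ Dm ∈ H0, ((a15Box rX).filter fun v => nsq v = (Dm.1 : ℤ)).card = Dm.2 := fibres_of_histOK rX_range H0_lt_A15 histOK_X

/-- ★ COVER, class X: every nonzero root-centred frame vector of the box with squared length `< 575` sits on a booked shell of `H0`. -/
theorem cover_X : ∀ v ∈ a15Box rX, nsq v < 575 → (nsq v).toNat ∈ H0.map Prod.fst := cover_of_list rX_range coverL_X

end Summit.AtomisticToContinuum.Crystallization.Theorems.FrustratedLawDichotomyDRowsA15KernelX
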